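import Literature.Computability.Complexity.KarpLipton
import Literature.Computability.Complexity.NPClosureProofs
import Literature.Computability.Complexity.SigmaPAlternation
import HarnessLib

/-!
# Collapse of the polynomial hierarchy to a level `Σᵢᵖ`, `i ≥ 1`; in particular `NP = coNP → PH = NP`

Stockmeyer's collapse theorem (Stockmeyer 1976, Thm. 3.1 / Cor.; Arora–Barak 2009, Thm. 5.4 (1):
"for every `i ≥ 1`, if `Σᵢᵖ = Πᵢᵖ` then `PH = Σᵢᵖ`"), proved over the tree's classes
(`SigmaP`, `PiP`, `PH` of `PolyHierarchy.lean`) for EVERY level `i + 1`, generalising the level-2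
instance `KarpLipton.PH_eq_SigmaP_two_of_PiP_two_subset` already in the tree (same induction:
`Σₖ₊₁ = ∃ᵖ·coΣₖ ⊆ ∃ᵖ·coΣᵢ₊₁ = ∃ᵖ·Πᵢ₊₁ ⊆ ∃ᵖ·Σᵢ₊₁ ⊆ Σᵢ₊₁`, the last step being the quantifier
merging `KarpLipton.polyExists_SigmaP_succ_subset`).

The level-1 case is the classical consequence `NP = coNP → PH = NP` (Arora–Barak 2009, Thm. 5.4
with `Σ₁ᵖ = NP`, `Π₁ᵖ = coNP`), recorded together with its contrapositives
`PH ≠ NP → NP ≠ coNP` and `Σₖᵖ ≠ NP → NP ≠ coNP` (`k ≥ 1`), the standard structural evidence for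
`NP ≠ coNP` (equivalently, by Cook–Reckhow, for the non-existence of a polynomially bounded
propositional proof system).

Sources: L. J. Stockmeyer, *The polynomial-time hierarchy*, TCS 3 (1976), §3–4;
S. Arora, B. Barak, *Computational Complexity* (2009), Thm. 5.4 and Def. 5.3.
Deliberately not here: the downward direction `P = NP → PH = P` (in `KarpLipton.lean` /
`ClayProblemConsequences.lean` circle) and relativised versions.
-/

namespace Literature.Computability.Complexity

open Nondeterministic

/-- **Stockmeyer's collapse** (Arora–Barak 2009, Thm. 5.4 (1)): for every level `i + 1 ≥ 1`, if
`Πᵢ₊₁ᵖ ⊆ Σᵢ₊₁ᵖ` then `PH = Σᵢ₊₁ᵖ`. By induction on `k`, `Σₖᵖ ⊆ Σᵢ₊₁ᵖ`: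
`Σₖ₊₁ = ∃ᵖ·coΣₖ ⊆ ∃ᵖ·coΣᵢ₊₁ = ∃ᵖ·Πᵢ₊₁ ⊆ ∃ᵖ·Σᵢ₊₁ ⊆ Σᵢ₊₁`.
[cite: AroraBarakCC2009, Thm. 5.4] -/
theorem PH_eq_SigmaP_succ_of_PiP_subset (i : ℕ) (h : PiP (i + 1) ⊆ SigmaP (i + 1)) :
    PH = SigmaP (i + 1) := by
  refine Set.Subset.antisymm ?_ (SigmaP_subset_PH (i + 1))
  have key : ∀ k, SigmaP k ⊆ SigmaP (i + 1) := by
    intro k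
    induction k with
    | zero => exact P_subset_SigmaP (i + 1)
    | succ k ih =>
      intro L hL
      have h1 : L ∈ polyExists (co (SigmaP (i + 1))) := polyExists_mono (co_mono ih) hL
      exact KarpLipton.polyExists_SigmaP_succ_subset i (polyExists_mono h h1)
  intro L hL
  obtain ⟨k, hk⟩ := Set.mem_iUnion.1 hL
  exact key k hk

/-- Stockmeyer's collapse in the equality form: `Σᵢ₊₁ᵖ = Πᵢ₊₁ᵖ → PH = Σᵢ₊₁ᵖ`.
[cite: Stockmeyer1976, §3] -/
theorem PH_eq_SigmaP_succ_of_SigmaP_eq_PiP (i : ℕ) (h : SigmaP (i + 1) = PiP (i + 1)) :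
    PH = SigmaP (i + 1) :=
  PH_eq_SigmaP_succ_of_PiP_subset i h.symm.subset

/-- **`NP = coNP` collapses the polynomial hierarchy to `NP`** (level one of Stockmeyer's
collapse, with `Σ₁ᵖ = NP` and `Π₁ᵖ = coNP`). [cite: AroraBarakCC2009, Thm. 5.4] -/
theorem PH_eq_NP_of_NP_eq_coNP (h : NP = coNP) : PH = NP := by
  have h1 : PiP 1 ⊆ SigmaP 1 := by
    rw [PiP_one_holds, SigmaP_one_holds, ← h]
  rw [PH_eq_SigmaP_succ_of_PiP_subset 0 h1, SigmaP_one_holds]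

/-- Contrapositive: if the polynomial hierarchy does not collapse to `NP` then `NP ≠ coNP`.
[cite: AroraBarakCC2009, Thm. 5.4] -/
theorem NP_ne_coNP_of_PH_ne_NP (h : PH ≠ NP) : NP ≠ coNP :=
  fun heq => h (PH_eq_NP_of_NP_eq_coNP heq)

/-- If some level `Σₖᵖ`, `k ≥ 1`, differs from `NP`, then `NP ≠ coNP` (for `NP = coNP` gives
`NP = Σ₁ᵖ ⊆ Σₖᵖ ⊆ PH = NP`, monotonicity `SigmaP_mono_le` of `SigmaPAlternation.lean`).
[cite: AroraBarakCC2009, Thm. 5.4] -/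
theorem NP_ne_coNP_of_SigmaP_ne_NP {k : ℕ} (hk : 1 ≤ k) (h : SigmaP k ≠ NP) : NP ≠ coNP := by
  intro heq
  apply h
  apply Set.Subset.antisymm
  · rw [← PH_eq_NP_of_NP_eq_coNP heq]
    exact SigmaP_subset_PH k
  · rw [← SigmaP_one_holds]
    exact SigmaP_mono_le hk

/-- Likewise for the `Π` side: if some `Πₖᵖ`, `k ≥ 1`, differs from `NP`, then `NP ≠ coNP`
(for `NP = coNP` gives `Πₖᵖ = coΣₖᵖ = coNP = NP`). [cite: AroraBarakCC2009, Thm. 5.4] -/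
theorem NP_ne_coNP_of_PiP_ne_NP {k : ℕ} (hk : 1 ≤ k) (h : PiP k ≠ NP) : NP ≠ coNP := by
  intro heq
  apply h
  have hS : SigmaP k = NP := by
    by_contra hne
    exact NP_ne_coNP_of_SigmaP_ne_NP hk hne heq
  rw [PiP_eq_co, hS]
  exact heq.symm

end Literature.Computability.Complexity
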